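import Literature.NumberTheory.DiophantineGeometry.GenEllCuspTransfer
import HarnessLib

/-!
# [GenEll] Thm. 2.1, proof: the transfer along the power maps `x ↦ x^n`

S. Mochizuki, *Arithmetic elliptic curves in general position*, Math. J. Okayama Univ. 52 (2010)
[cite: MochizukiGenEll2010, Thm 2.1 pp.11–13]. Instance of the transfer lemma
(`GenEllCuspTransfer.vojtaIneq_transfer`) for the cusp-preserving Belyi maps `γ_n : x ↦ x^n`
(`n ≥ 1`): `γ_n⁻¹{0,1,∞} = {0, ∞} ∪ μ_n`, `|γ_n⁻¹{0,1,∞}| = n + 2`, reduced pullback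
`C + B_n` with `B_n = V(1 + t + ⋯ + t^{n−1})` (= `μ_n ∖ {1}`) of degree `n − 1`, and the EXACT height
identity `h(x^n) = n·h(x)` (Mathlib `Height.logHeight₁_pow`). Result (`vojtaIneq_transfer_pow`): Vojta
with `ε` on a set `T` in degree `≤ d` implies Vojta with `(1+ε)/(1 − ε(n−1)) − 1` on the points `x` of
degree `≤ d` with `(ℚ(x^n), x^n) ∈ T`, whenever `ε(n−1) < 1`. This is the mechanism "PHI∘γ" of the cell's
ℙ¹-route for GenEllTwo (the power family of the menu; the torsion locus `μ_∞` is where it cannot help).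
Classical; abc-iut cell, route item GenEllTwo (stmt-ABC-19679), work package W2; nothing here bears on
[IUTchIII] Cor. 3.12.
-/

noncomputable section

open NumberField Height Polynomial Finset

namespace Literature.NumberTheory.DiophantineGeometry.GenEll

namespace P1FiniteMap

/-- The power map `γ_n = (t^n : 1) : ℙ¹ → ℙ¹`, `x ↦ x^n`, as a finite map of degree `n`.
[cite: MochizukiGenEll2010, Thm 2.1 p.13] -/
def pow (n : ℕ) : P1FiniteMap where
  num := X ^ n
  den := 1
  deg := n
  natDegree_num_le := by rw [natDegree_X_pow]
  natDegree_den_le := by rw [natDegree_one]; exact Nat.zero_le _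

/-- `γ_n(x) = x^n`. [cite: MochizukiGenEll2010, Thm 2.1 p.13] -/
@[simp] theorem eval_pow (n : ℕ) {F : Type*} [Field F] (x : F) : (pow n).eval x = x ^ n := by
  simp [eval, pow]

/-- The polynomial of the pullback divisor `γ_n*C` is `t^n · 1 · (t^n − 1)`.
[cite: MochizukiGenEll2010, Prop 1.7 p.9] -/
theorem pullbackCusps_pow_poly (n : ℕ) : (pow n).pullbackCusps.poly = X ^ n * 1 * (X ^ n - 1) := rfl

/-- `(t² − t)·(1 + t + ⋯ + t^{n−1}) = t·(t^n − 1)`. [folklore] -/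
private theorem cusps_mul_geom_sum (n : ℕ) :
    (X ^ 2 - X : ℤ[X]) * ∑ i ∈ range n, X ^ i = X * (X ^ n - 1) := by
  rw [← geom_sum_mul X n]
  ring

/-- THE REDUCED-PULLBACK CERTIFICATE of the power map: `γ_n⁻¹(C)_red = C + B_n`,
`B_n = V(1 + t + ⋯ + t^{n−1})` of degree `n − 1`; identity
`t^n (t^n − 1) · (t^n − 1)^{n−1} = ((t² − t)(1 + ⋯ + t^{n−1}))^n`, `c = 1`, `k = n`.
(Riemann–Hurwitz count `|γ_n⁻¹{0,1,∞}| = n + 2`: `γ_n` is a cusp-preserving Belyi map.)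
[cite: MochizukiGenEll2010, Prop 1.7 p.9] -/
def powReduced (n : ℕ) (hn : 1 ≤ n) : ReducedPullback (pow n) where
  B := { poly := ∑ i ∈ range n, X ^ i
         deg := n - 1
         natDegree_le := natDegree_sum_le_of_forall_le _ _ fun i hi => by
           rw [natDegree_X_pow]; have := mem_range.mp hi; omega }
  k := n
  one_le_k := hn
  c := 1
  c_ne_zero := one_ne_zero
  h := (X ^ n - 1) ^ (n - 1)
  hdiv := by
    change X ^ n * 1 * (X ^ n - 1) * (X ^ n - 1) ^ (n - 1) =
      C 1 * ((X ^ 2 - X) * ∑ i ∈ range n, X ^ i) ^ n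
    rw [cusps_mul_geom_sum, map_one, one_mul, mul_one, mul_pow, mul_assoc, ← pow_succ',
      Nat.sub_add_cancel hn]
  hdeg := by
    change ((X ^ n - 1) ^ (n - 1) : ℤ[X]).natDegree + 3 * n ≤ n * (3 + (n - 1))
    have h1 : ((X ^ n - 1 : ℤ[X])).natDegree ≤ n :=
      (natDegree_sub_le _ _).trans (by rw [natDegree_X_pow, natDegree_one]; exact max_le le_rfl n.zero_le)
    have h2 : ((X ^ n - 1) ^ (n - 1) : ℤ[X]).natDegree ≤ (n - 1) * n :=
      natDegree_pow_le.trans (Nat.mul_le_mul_left _ h1)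
    have h3 : n * (3 + (n - 1)) = (n - 1) * n + 3 * n := by ring
    omega
  j := 1
  hBdiv := by
    change (∑ i ∈ range n, X ^ i : ℤ[X]) ∣ (X ^ n * 1 * (X ^ n - 1)) ^ 1
    rw [pow_one]
    exact dvd_mul_of_dvd_right ⟨X - 1, (geom_sum_mul X n).symm⟩ _
  ne_zero := by
    change (X ^ n * 1 * (X ^ n - 1) : ℤ[X]) ≠ 0
    rw [mul_one, ← C_1]
    exact mul_ne_zero (pow_ne_zero _ X_ne_zero) (X_pow_sub_C_ne_zero hn 1)

/-- `deg B_n = n − 1`. [cite: MochizukiGenEll2010, Prop 1.7 p.9] -/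
@[simp] theorem powReduced_B_deg (n : ℕ) (hn : 1 ≤ n) : (powReduced n hn).B.deg = n - 1 := rfl

end P1FiniteMap

namespace NFPoint

/-- A point is off `γ_n⁻¹(C)` iff `x ≠ 0` and `x^n ≠ 1`. [cite: MochizukiGenEll2010, Prop 1.7 p.9] -/
theorem offDiv_pow_iff (n : ℕ) (P : NFPoint) :
    P.OffDiv (P1FiniteMap.pow n).pullbackCusps ↔ (P.x ≠ 0 ∧ P.x ^ n ≠ 1) := by
  simp only [OffDiv, P1FiniteMap.pullbackCusps_pow_poly, map_mul, map_sub, map_pow, aeval_X,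
    map_one, mul_one, ne_eq, mul_eq_zero, sub_eq_zero, not_or]
  exact ⟨fun h => ⟨fun h0 => h.1 (by rw [h0]; exact zero_pow (by rintro rfl; simp at h)), h.2⟩,
    fun h => ⟨pow_ne_zero _ h.1, h.2⟩⟩

/-- Membership in the `γ_n`-preimage set: for `x ≠ 0`, `x^n ≠ 1`, the point `x` lies in
`γ_n.preimageSet T` iff `(ℚ(x^n), x^n) ∈ T`. [cite: MochizukiGenEll2010, Thm 2.1 p.13] -/
theorem mem_preimageSet_pow_iff {n : ℕ} {T : Set NFPoint} (P : NFPoint) (h0 : P.x ≠ 0)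
    (h1 : P.x ^ n ≠ 1) :
    P ∈ (P1FiniteMap.pow n).preimageSet T ↔ P.imageAt (P.x ^ n) ∈ T := by
  have hoff : P.OffDiv (P1FiniteMap.pow n).pullbackCusps := (offDiv_pow_iff n P).mpr ⟨h0, h1⟩
  simp only [P1FiniteMap.preimageSet, Set.mem_setOf_eq, P1FiniteMap.eval_pow]
  exact ⟨fun h => h hoff, fun h _ => h⟩

/-- THE HEIGHT IDENTITY for the power map: `n · ht(x) = ht(ℚ(x^n), x^n)` exactly
(`h(x^n) = n·h(x)`, Mathlib `Height.logHeight₁_pow`; [GenEll] Prop. 1.4 (i), (iii) with constant `0`).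
[cite: MochizukiGenEll2010, Prop 1.4 (i) p.6] -/
theorem hlow_pow (n : ℕ) : ∀ P : NFPoint, P.OffDiv (P1FiniteMap.pow n).pullbackCusps →
    ((P1FiniteMap.pow n).deg : ℝ) * P.ht ≤
      (P.degree : ℝ)⁻¹ * logHeight₁ ((P1FiniteMap.pow n).eval P.x) + 0 := by
  intro P _
  rw [P1FiniteMap.eval_pow, logHeight₁_pow, add_zero]
  change (n : ℝ) * ((P.degree : ℝ)⁻¹ * logHeight₁ P.x) ≤ (P.degree : ℝ)⁻¹ * (n * logHeight₁ P.x)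
  rw [mul_left_comm]

/-- **TRANSFER ALONG `x ↦ x^n`** ([GenEll] Thm. 2.1, proof p. 13, for the cusp-preserving Belyi map
`γ_n`): if Vojta with `ε ≥ 0` holds on `T` in degree `≤ d` and `ε(n−1) < 1`, then Vojta with
`(1+ε)/(1 − ε(n−1)) − 1` holds, in degree `≤ d`, on the set of points `x` with `(ℚ(x^n), x^n) ∈ T`
(points with `x = 0` or `x^n = 1` included — they have bounded height).
[cite: MochizukiGenEll2010, Thm 2.1 p.13] -/
theorem vojtaIneq_transfer_pow {n : ℕ} (hn : 1 ≤ n) {T : Set NFPoint} {d : ℕ} {ε : ℝ} (hε : 0 ≤ ε)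
    (hεn : ε * (n - 1) < 1) (hV : VojtaIneq T d ε) :
    VojtaIneq ((P1FiniteMap.pow n).preimageSet T) d ((1 + ε) / (1 - ε * (n - 1)) - 1) := by
  have hcast : (((P1FiniteMap.powReduced n hn).B.deg : ℕ) : ℝ) = (n : ℝ) - 1 := by
    rw [P1FiniteMap.powReduced_B_deg, Nat.cast_sub hn, Nat.cast_one]
  have hdeg : ((P1FiniteMap.pow n).deg : ℝ) = n := rfl
  have ha : (1 + ε) * ((P1FiniteMap.powReduced n hn).B.deg : ℝ) < (P1FiniteMap.pow n).deg := by
    rw [hcast, hdeg]; nlinarith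
  have h := vojtaIneq_transfer (P1FiniteMap.powReduced n hn) (hlow_pow n) hε ha hV
  rw [hcast, hdeg] at h
  have he : (n : ℝ) - (1 + ε) * (n - 1) = 1 - ε * (n - 1) := by ring
  rwa [he] at h

end NFPoint

end Literature.NumberTheory.DiophantineGeometry.GenEll

end
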